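import Summits.CriticalPhenomena.PercolationContinuityZ3.Theorems.PercNearOneGluingNoHeavyLowerTailMajorityGluingQCertSymParts
import HarnessLib

/-!
# Part 15 of 18 of the orbit certificate of the cell `(12,7)` at `c = 157/100`: data and digest (lane prim-rate, constants-miner 1, gen 36; generated by cert/mksym.py)

Support file for the closed crux `NoHeavyLowerTail` (stmt-CriticalPhenomena-4575), majority-gluing line.  The symmetrised certificate of the cell `(12,7)`
(kit j286395, symcert.py) is checked IN PARTS (`…MajorityGluingQCertSymParts`): this file holds part 15 (1 multiplier terms, 1 marginal slacks,
0 rows, 0 squares; 3636 contributions) and its DIGEST `twelveSevenSymP15D` (56 orbit keys), verified by `decide +kernel` (`twelveSevenSymP15_digest`).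
The parts are glued in `…MajorityGluingQCertSymTwelveSeven`.  No sorries. [cite: VandenbergKahn2001, Thm 1.2 (p. 123)]
-/

namespace Summit.CriticalPhenomena.PercolationContinuityZ3.Theorems

namespace HubOnly
namespace QCert

/-- Row representatives of part 15: `(A, X, B, Y, n, masks of f(A,X), f(B,Y), f(A∪B,X∩Y), f(∅,X∪Y))`. -/
def twelveSevenSymP15Rows : List RowE :=
  []

/-- Square representatives of part 15: `(a, b, n, mask₁, mask₂)`. -/
def twelveSevenSymP15Sqs : List SqE :=
  []

/-- **Part 15** of the `(12,7)` orbit certificate at `157/100`. -/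
def twelveSevenSymP15 : SymCert :=
  ⟨⟨12, 7, 157, 100, 1, [], [], []⟩,
    [(1023, 370902015623293696)],
    [(0, 127, 29030610697346560000)],
    [twelveSevenSymP15Rows], [twelveSevenSymP15Sqs]⟩

/-- The digest of part 15: `(orbit key, coefficient total)` in increasing key order (computed by cert/mksym.py, verified below). -/
def twelveSevenSymP15D : List (ℕ × ℤ) :=
  [((4224 : ℕ), (29030610697346560000 : ℤ)), (12418, 174183664184079360000), (12544, 145153053486732800000), (28806, 435459160460198400000), 
    (28930, 870918320920396800000), (29184, 290306106973465600000), (61582, 580612213946931200000), (61702, 2177295802300992000000), 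
    (61954, 1741836641840793600000), (62464, 290306106973465600000), (127134, 435459160460198400000), (127246, 2903061069734656000000), 
    (127494, 4354591604601984000000), (128002, 1741836641840793600000), (129024, 145153053486732800000), (258238, 174183664184079360000), 
    (258334, 2177295802300992000000), (258574, 5806122139469312000000), (259078, 4354591604601984000000), (260098, 870918320920396800000), 
    (262144, 29030610697346560000), (520446, 29030610697346560000), (520510, 870918320920396800000), (520574, 145153053486732800000), 
    (520734, 4354591604601984000000), (520766, 1741836641840793600000), (520830, 290306106973465600000), (521230, 5806122139469312000000), 
    (521246, 4354591604601984000000), (521278, 1741836641840793600000), (521342, -4160518080506058752000), (522246, 2177295802300992000000), 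
    (522254, 2903061069734656000000), (522270, 2177295802300992000000), (522302, -14706966335257938432000), (522366, 145153053486732800000), 
    (524290, 174183664184079360000), (524294, 435459160460198400000), (524302, 580612213946931200000), (524318, -8911271633246802739200), 
    (524350, 174183664184079360000), (524414, 29030610697346560000), (1045758, -1669059070304821632000), (1046654, -8901648374959048704000), 
    (1048638, -7788942328089167616000), (2094590, -370902015623293696000), (2095358, -3338118140609643264000), (2097278, -4450824187479524352000), 
    (4192254, -37090201562329369600), (4192766, -741804031246587392000), (4193278, -74180403124658739200), (4194558, -1669059070304821632000), 
    (4194814, -370902015623293696000), (4195326, -37090201562329369600), (16781439, -29030610697346560000), (16782335, 58231616452857110272)]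

/-- **The digest of part 15 is `twelveSevenSymP15D`** (kernel evaluation of the part's 3636 contributions). -/
theorem twelveSevenSymP15_digest : twelveSevenSymP15.digest 20 = twelveSevenSymP15D := by
  decide +kernel

end QCert
end HubOnly

end Summit.CriticalPhenomena.PercolationContinuityZ3.Theorems
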